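import Literature.Computability.Complexity.IteratedMultiplicationTC0
import Literature.Computability.Cryptography.NaorReingoldTC0Size
import HarnessLib

/-!
# Iterated multiplication is in `TC⁰`: proof of `hesseAllenderBarrington2002_imult_mem_TC0`

This file discharges the named fact `hesseAllenderBarrington2002_imult_mem_TC0 : IMULT ∈ TC0`
of `IteratedMultiplicationTC0.lean` (Hesse–Allender–Barrington 2002, Cor. 6.3 with §2.3:
"Division and Imult are in FOM" = DLOGTIME-uniform `TC⁰`; the tree's `TC0` is the non-uniform
class, so the statement to prove is the non-uniform one, which the paper recalls on p. 7:
"It was shown in [15] that Iterated Multiplication is in P-uniform `NC¹`. It was observed later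
by Reif [46, 47] that the same algorithm can be implemented in P-uniform `TC⁰`").

**The proof formalised** is the non-uniform Chinese-remainder algorithm of Beame–Cook–Hoover
[15] as presented by Vollmer (1999), §1.4.2, proof of Thm. 1.40 (`ITMULT ≤cd MAJ`), assembled
from the layers the tree already has (all proved):

1. (depth `4`, `ThresholdGadgets.acRealOver_wsum_pred`) for every prime `p` of
   `S = primeSet (n²)` (all primes `≤ L = primeBound (n²)`, `∏ S > 4·2^{n²}`,
   `SmallPrimesCRT.lean`) and every block `A_j`, the one-hot code of `A_j mod p` — a predicate of
   the small weighted sum `∑_k [bit k of A_j]·(2^k mod p)` (Vollmer's eq. (1.4));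
2. (depth `9`, `TCResidueLayer.crtLayer`) the one-hot codes of `Π mod p`, `Π = ∏_j A_j`, for all
   `p ∈ S`, by discrete logarithms (eqs. (1.5)–(1.6)), together with the one-hot code of the CRT
   quotient `κ` (eq. (1.7); `SmallPrimes.crtK_eq_approx`).  The layer of the tree multiplies
   HARD-WIRED constants selected by its input wires; we feed it the wires of step 1 and the table
   of CRT lifts `lift p r ≡ r (mod p)`, `≡ 1 (mod q)` (`q ∈ S ∖ {p}`), whose selected product is
   `≡ ∏_j (A_j mod p) ≡ Π (mod p)` for every `p ∈ S` simultaneously (`prodSel_mod`);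
3. (depth `10`, `IteratedAdditionTC0` through `NRTC0.acVecOver_candBitsG`) the bits of
   `∑_{p ∈ S} crtT p (Π mod p) + (2^T − κ·M) = 2^T + Π` — iterated addition of hard-wired numbers
   masked by the wires (Vollmer's `a = a' − q·p`, Thm. 1.37);
4. (depth `2`) the output `⋁_i [#ones of the index part = i] ∧ [bit i of Π]`, the count being one
   more threshold layer (`acRealOver_wsum_eq`) laid beside step 3.

Total depth `25`; the size is bounded by the explicit polynomial `IMult.outR` (written once over a
commutative semiring and evaluated in `ℕ[X]`, as in `NaorReingoldTC0Size.lean`).  Input lengths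
not of the form `2n²` get the constant circuit.  Everything here is proved; no new facts.

## References

* W. Hesse, E. Allender, D. A. M. Barrington, *Uniform constant-depth threshold circuits for
  division and iterated multiplication*, J. Comput. System Sci. 65 (2002) 695–716, §2 (p. 4),
  §3 (p. 7), Cor. 6.3 (p. 16) [HesseAllenderBarrington2002].
* H. Vollmer, *Introduction to Circuit Complexity* (1999), §1.4.2, Thm. 1.40 and its proof
  (eqs. (1.4)–(1.7)), Thm. 1.37 [Vollmer1999].
* P. Beame, S. Cook, H. J. Hoover, *Log depth circuits for division and related problems*,
  SIAM J. Comput. 15 (1986) 994–1003.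
-/

noncomputable section

namespace Literature.Computability.Complexity

open Finset SmallPrimes ItAdd Polynomial
open Literature.Computability.Cryptography.NRTC0 (xbitG XbitsG total_XbitsG_eq acVecOver_candBitsG
  candSizeG quotRangeR resBitSizeR crtLayerSizeR RbR itAddBoundR map_quotRangeR map_crtLayerSizeR
  map_itAddBoundR quotRange_eq crtLayerSize_eq itAddSize_le itAddBoundR_mono)

namespace IMult

variable {n : ℕ}

/-! ### Parameters: the small primes -/

/-- The prime bound `L = primeBound (n²)` (all CRT primes are `≤ L`). [cite: Vollmer1999, §1.4.2, proof of Thm. 1.40] -/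
def L (n : ℕ) : ℕ := primeBound (n * n)

/-- The CRT prime set `S = primeSet (n²)`: all primes `≤ L`, with `∏ S > 4 · 2^{n²}`. [cite: Vollmer1999, §1.4.2, proof of Thm. 1.40, and Appendix A7] -/
def S (n : ℕ) : Finset ℕ := primeSet (n * n)

/-- Members of `S` are prime. [folklore] -/
theorem S_prime (n : ℕ) : ∀ p ∈ S n, p.Prime := fun _ hp => (mem_primeSet.1 hp).2

/-- Members of `S` are `≤ L`. [folklore] -/
theorem S_le (n : ℕ) : ∀ p ∈ S n, p ≤ L n := fun _ hp => Nat.lt_succ_iff.1 (mem_primeSet.1 hp).1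

/-- `2 ∈ S`. [folklore] -/
theorem two_mem_S (n : ℕ) : 2 ∈ S n :=
  mem_primeSet.2 ⟨Nat.lt_succ_of_le (le_add_left (by norm_num)), Nat.prime_two⟩

/-- `S` is nonempty. [folklore] -/
theorem card_S_pos (n : ℕ) : 0 < (S n).card := Finset.card_pos.2 ⟨2, two_mem_S n⟩

/-- `4 · 2^{n²} < M = ∏ S`. [cite: Vollmer1999, §1.4.2, proof of Thm. 1.40 (`p = ∏ p_i` exceeds the product), Appendix A7] -/
theorem four_mul_two_pow_lt_crtM (n : ℕ) : 4 * 2 ^ (n * n) < crtM (S n) :=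
  four_mul_two_pow_lt_primorial (n * n)

/-! ### The input convention of the structured circuit -/

/-- Input variables of the structured circuit: bit `k` of block `A_j` at `inl (j, k)`, index bit
`t` at `inr t`. [cite: HesseAllenderBarrington2002, §2 (p. 4), Iterated Multiplication] -/
abbrev Inp (n : ℕ) : Type := (Fin n × Fin n) ⊕ Fin (n * n)

/-- The value of block `A_j = ∑_k [bit k] 2^k`. [cite: HesseAllenderBarrington2002, §2 (p. 4)] -/
def aval (x : Inp n → Bool) (j : Fin n) : ℕ :=
  wsum (fun k : Fin n => 2 ^ (k : ℕ)) (fun k => x (Sum.inl (j, k)))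

/-- `A_j < 2^n`. [folklore] -/
theorem aval_lt (x : Inp n → Bool) (j : Fin n) : aval x j < 2 ^ n := by
  unfold aval
  refine (wsum_le _ _).trans_lt ?_
  rw [Fin.sum_univ_eq_sum_range (fun k => 2 ^ k) n]
  exact Nat.geomSum_lt le_rfl fun k hk => Finset.mem_range.1 hk

/-- The product `Π = ∏_j A_j`. [cite: HesseAllenderBarrington2002, §2 (p. 4)] -/
def prodA (x : Inp n → Bool) : ℕ := ∏ j, aval x j

/-- `Π ≤ 2^{n²}`. [folklore] -/
theorem prodA_le (x : Inp n → Bool) : prodA x ≤ 2 ^ (n * n) := by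
  unfold prodA
  calc ∏ j, aval x j ≤ ∏ _j : Fin n, 2 ^ n :=
        Finset.prod_le_prod (fun j _ => Nat.zero_le _) fun j _ => (aval_lt x j).le
    _ = 2 ^ (n * n) := by rw [Finset.prod_const, card_univ, Fintype.card_fin, ← pow_mul]

/-- `4 Π < M`. [folklore] -/
theorem four_mul_prodA_lt (x : Inp n → Bool) : 4 * prodA x < crtM (S n) :=
  (Nat.mul_le_mul_left 4 (prodA_le x)).trans_lt (four_mul_two_pow_lt_crtM n)

/-- `Π < M`. [folklore] -/
theorem prodA_lt_crtM (x : Inp n → Bool) : prodA x < crtM (S n) := by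
  have := four_mul_prodA_lt x; omega

/-- The number of ones of the index part. [cite: HesseAllenderBarrington2002, §2 (p. 4): the index `i` of the queried bit] -/
def cnt (x : Inp n → Bool) : ℕ := wsum (fun _ : Fin (n * n) => 1) (fun t => x (Sum.inr t))

/-- `cnt ≤ n²`. [folklore] -/
theorem cnt_le (x : Inp n → Bool) : cnt x ≤ n * n :=
  (wsum_le _ _).trans (by simp)

/-! ### Layer 1: the residues of the blocks modulo the small primes (Vollmer's eq. (1.4)) -/

/-- The weights `2^k mod p` of the residue computation `A_j mod p = (∑_k [bit k] (2^k mod p)) mod p`. [cite: Vollmer1999, §1.4.2, proof of Thm. 1.40, eq. (1.4)] -/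
def pw (n p : ℕ) (k : Fin n) : ℕ := 2 ^ (k : ℕ) % p

/-- The weighted sum with reduced weights has the same residue. [cite: Vollmer1999, §1.4.2, proof of Thm. 1.40, eq. (1.4)] -/
theorem wsum_pw_mod (p : ℕ) (b : Fin n → Bool) :
    wsum (pw n p) b % p = wsum (fun k : Fin n => 2 ^ (k : ℕ)) b % p := by
  unfold wsum pw
  rw [Finset.sum_nat_mod]
  conv_rhs => rw [Finset.sum_nat_mod]
  refine congrArg (· % p) (Finset.sum_congr rfl fun k _ => ?_)
  exact Nat.mod_mul_mod _ _ _

/-- The block selector: the residue `A_j mod p` as an element of `Fin (L + 1)` (reduced once more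
modulo `L + 1`, the identity since `p ≤ L`). [folklore] -/
def bsel (n : ℕ) (x : Inp n → Bool) (q : ↥(S n) × Fin n) : Fin (L n + 1) :=
  ⟨aval x q.2 % (q.1 : ℕ) % (L n + 1), Nat.mod_lt _ (Nat.succ_pos _)⟩

/-- The block selector is the residue. [folklore] -/
theorem bsel_val (x : Inp n → Bool) (q : ↥(S n) × Fin n) :
    ((bsel n x q : Fin (L n + 1)) : ℕ) = aval x q.2 % (q.1 : ℕ) :=
  Nat.mod_eq_of_lt (Nat.lt_succ_of_le
    ((Nat.mod_lt _ (S_prime n _ q.1.2).pos).le.trans (S_le n _ q.1.2)))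

/-- Size of one residue block of layer 1. [folklore] -/
def blk₁ (n : ℕ) : ℕ := (n * L n + 1) * (4 * (n * L n + (n * L n + 1)) + 11) + 1

/-- **One wire of layer 1**: `[A_j mod p = r]` at depth `4` — a predicate of the small weighted sum
`∑_k [bit k of A_j]·(2^k mod p)`. [cite: Vollmer1999, §1.4.2, proof of Thm. 1.40, eq. (1.4), and §1.4.1, proof of Thm. 1.37] -/
theorem acRealOver_bselBit (q : ↥(S n) × Fin n) (r : Fin (L n + 1)) :
    ACRealOver tcBasis (fun x : Inp n → Bool => oneHotWires (bsel n) x (q, r)) 4 (blk₁ n) := by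
  obtain ⟨⟨p, hp⟩, j⟩ := q
  have hpr : p.Prime := S_prime n p hp
  have hpL : p ≤ L n := S_le n p hp
  have hcsum : (∑ k, pw n p k) ≤ n * L n := by
    calc (∑ k, pw n p k) ≤ ∑ _k : Fin n, L n :=
          Finset.sum_le_sum fun k _ => ((Nat.mod_lt _ hpr.pos).le.trans hpL)
      _ = n * L n := by simp
  have hR : (∑ k, pw n p k) < n * L n + 1 := Nat.lt_succ_of_le hcsum
  have h := (acRealOver_wsum_pred (pw n p) hR (fun s => s % p = (r : ℕ))).rewire
    (fun k : Fin n => (Sum.inl (j, k) : Inp n))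
  refine (h.congr fun x => ?_).mono le_rfl ?_
  · rw [oneHotWires_apply, decide_eq_decide, Fin.ext_iff, bsel_val, wsum_pw_mod]
    exact Iff.rfl
  · unfold blk₁
    gcongr

/-- The number of wires of layer 1 (= the number of selectors of layer 2). [folklore] -/
def cF (n : ℕ) : ℕ := Fintype.card ((↥(S n) × Fin n) × Fin (L n + 1))

/-- Size of layer 1. [folklore] -/
def layer1Size (n : ℕ) : ℕ := cF n * blk₁ n

/-- **Layer 1**: the one-hot residue codes `[A_j mod p = r]` of all blocks modulo all primes of
`S`, depth `4`. [cite: Vollmer1999, §1.4.2, proof of Thm. 1.40, eq. (1.4)] -/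
theorem acVecOver_layer1 : ACVecOver tcBasis (oneHotWires (bsel n)) 4 (layer1Size n) :=
  acVecOver_ofBlocks_fintype_const (κ := (↥(S n) × Fin n) × Fin (L n + 1))
    (f := fun qr x => oneHotWires (bsel n) x qr) fun qr => acRealOver_bselBit qr.1 qr.2

/-! ### The factor table: CRT lifts of the residues -/

/-- The CRT lift `lift p r ≡ r (mod p)`, `≡ 1 (mod q)` for `q ∈ S ∖ {p}`. [cite: Vollmer1999, §1.4.2, proof of Thm. 1.40, eq. (1.7) (the numbers `r_j s_j`)] -/
def lift (n p r : ℕ) : ℕ := crtT (S n) p r + ∑ q ∈ (S n).erase p, crtT (S n) q 1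

/-- `lift p r ≡ r (mod p)`. [folklore] -/
theorem lift_mod_self {p : ℕ} (hp : p ∈ S n) (r : ℕ) : lift n p r % p = r % p := by
  have h0 : ∑ q ∈ (S n).erase p, crtT (S n) q 1 % p = 0 := Finset.sum_eq_zero fun q hq => by
    obtain ⟨hqp, -⟩ := Finset.mem_erase.1 hq
    exact crtT_mod_other (S n) hp (Ne.symm hqp) 1
  unfold lift
  rw [Nat.add_mod, crtT_mod_self (S n) (S_prime n) hp, Finset.sum_nat_mod, h0]
  simp

/-- `lift p r ≡ 1 (mod q)` for `q ∈ S`, `q ≠ p`. [folklore] -/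
theorem lift_mod_other {p q : ℕ} (hq : q ∈ S n) (hqp : q ≠ p) (r : ℕ) :
    lift n p r % q = 1 := by
  have hqP : q.Prime := S_prime n q hq
  have h1 : ∑ q' ∈ (S n).erase p, crtT (S n) q' 1 % q = 1 % q := by
    rw [Finset.sum_eq_single_of_mem q (Finset.mem_erase.2 ⟨hqp, hq⟩)]
    · exact crtT_mod_self (S n) (S_prime n) hq 1
    · intro q' _ hne
      exact crtT_mod_other (S n) hq (Ne.symm hne) 1
  unfold lift
  rw [Nat.add_mod, crtT_mod_other (S n) hq hqp, Finset.sum_nat_mod, h1]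
  simp only [zero_add, Nat.mod_mod]
  exact Nat.mod_eq_of_lt hqP.one_lt

/-- The factor table of layer 2: wire `((p, j), r)` selects the factor `lift p r`. [cite: Vollmer1999, §1.4.2, proof of Thm. 1.40] -/
def ftab (n : ℕ) (f : (↥(S n) × Fin n) × Fin (L n + 1)) : ℕ := lift n f.1.1 f.2

/-- On the one-hot wires the selected product is `∏_{(p, j)} lift p (A_j mod p)`. [folklore] -/
theorem prodSel_eq_prod (x : Inp n → Bool) :
    prodSel 1 (ftab n) (oneHotWires (bsel n) x) =
      ∏ q : ↥(S n) × Fin n, lift n q.1 (bsel n x q) := by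
  unfold prodSel
  rw [one_mul, Fintype.prod_prod_type]
  refine Fintype.prod_congr _ _ fun q => ?_
  simp only [oneHotWires_apply, decide_eq_true_eq, Finset.prod_ite_eq, Finset.mem_univ, if_true]
  rfl

/-- **The selected product has the residues of `Π`**: `∏ lift ≡ ∏_j (A_j mod q) ≡ Π (mod q)` for
every `q ∈ S`. [cite: Vollmer1999, §1.4.2, proof of Thm. 1.40, eqs. (1.4)–(1.6)] -/
theorem prodSel_mod (x : Inp n → Bool) {q : ℕ} (hq : q ∈ S n) :
    prodSel 1 (ftab n) (oneHotWires (bsel n) x) % q = prodA x % q := by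
  rw [prodSel_eq_prod, Fintype.prod_prod_type_right]
  unfold prodA
  rw [Finset.prod_nat_mod, Finset.prod_nat_mod (f := aval x)]
  refine congrArg (· % q) (Finset.prod_congr rfl fun j _ => ?_)
  rw [Finset.prod_nat_mod, Finset.prod_eq_single (⟨q, hq⟩ : ↥(S n))]
  · have h2 : ((bsel n x (⟨q, hq⟩, j) : Fin (L n + 1)) : ℕ) = aval x j % q := bsel_val x (⟨q, hq⟩, j)
    have h1 : lift n q (aval x j % q) % q = aval x j % q := by
      rw [lift_mod_self hq, Nat.mod_mod]
    show lift n q ((bsel n x (⟨q, hq⟩, j) : Fin (L n + 1)) : ℕ) % q % q = aval x j % q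
    rw [h2, h1, Nat.mod_mod]
  · intro p _ hpq
    exact lift_mod_other hq (fun h => hpq (Subtype.ext h.symm)) _
  · intro h; exact absurd (Finset.mem_univ _) h

/-- The residue selector of layer 2 carries `Π mod p`. [folklore] -/
theorem resSel_prodA (x : Inp n → Bool) (p : ↥(S n)) :
    ((resSel 1 (ftab n) (S n) (L n) (oneHotWires (bsel n) x) p : Fin (L n + 1)) : ℕ) =
      prodA x % (p : ℕ) := by
  rw [resSel_val _ p (S_prime n _ p.2) (S_le n _ p.2), prodSel_mod x p.2]

/-! ### Layer 2: residues of `Π` and the CRT quotient (Vollmer's eqs. (1.5)–(1.7)) -/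

/-- The wire index type after layer 2: the one-hot code of the quotient sum (`inl v`) and the
one-hot residue codes `[Π mod p = ρ]` (`inr (p, ρ)`). [folklore] -/
abbrev Wire (n : ℕ) : Type := Fin (quotRange (S n).card) ⊕ ↥(S n) × Fin (L n + 1)

/-- The wires after layer 2, as functions of the inputs. [cite: Vollmer1999, §1.4.2, proof of Thm. 1.40] -/
def wires (n : ℕ) (x : Inp n → Bool) : Wire n → Bool :=
  crtWires 1 (ftab n) (S n) (L n) (oneHotWires (bsel n) x)

/-- Size of layers 1–2. [folklore] -/
def wiresSize (n : ℕ) : ℕ := crtLayerSize (cF n) (S n).card (L n) + layer1Size n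

/-- **Layers 1–2**: residues of `Π` modulo the primes of `S` and the quotient code, depth `13`. [cite: Vollmer1999, §1.4.2, proof of Thm. 1.40] -/
theorem acVecOver_wires : ACVecOver tcBasis (wires n) 13 (wiresSize n) :=
  (crtLayer 1 (ftab n) (S_prime n) (S_le n)).comp acVecOver_layer1

/-- The quotient wires code the quotient sum (a propositional unfolding: the closed terms
`(S n).card`, `L n`, … must never be exposed to definitional evaluation). [folklore] -/
theorem wires_inl (x : Inp n → Bool) (v : Fin (quotRange (S n).card)) :
    wires n x (Sum.inl v) = decide (wsum (quotWt (S n) (L n))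
      (oneHotWires (resSel 1 (ftab n) (S n) (L n)) (oneHotWires (bsel n) x)) = (v : ℕ)) := by
  rw [wires, crtWires, Sum.elim_inl]

/-- The residue wires are the one-hot residue codes. [folklore] -/
theorem wires_inr (x : Inp n → Bool) (q : ↥(S n) × Fin (L n + 1)) :
    wires n x (Sum.inr q) =
      oneHotWires (resSel 1 (ftab n) (S n) (L n)) (oneHotWires (bsel n) x) q := by
  rw [wires, crtWires, Sum.elim_inr]

/-- The value coded by the quotient wires. [folklore] -/
def qv (x : Inp n → Bool) : ℕ :=
  wsum (quotWt (S n) (L n)) (oneHotWires (resSel 1 (ftab n) (S n) (L n)) (oneHotWires (bsel n) x))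

/-- `qv` unfolds (by `rfl`; used to keep later identifications syntactic). [folklore] -/
theorem qv_def (x : Inp n → Bool) : qv x = wsum (quotWt (S n) (L n))
    (oneHotWires (resSel 1 (ftab n) (S n) (L n)) (oneHotWires (bsel n) x)) := rfl

/-- `qv < quotRange |S|`. [folklore] -/
theorem qv_lt (x : Inp n → Bool) : qv x < quotRange (S n).card :=
  wsum_quotWt_lt (S_prime n) (S_le n) _

/-- **The CRT quotient of `Π` from the quotient wires**: `κ = (qv + |S|) / 2^b`. [cite: Vollmer1999, §1.4.2, proof of Thm. 1.40 (determination of `q`)] -/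
theorem crtK_eq (x : Inp n → Bool) :
    crtK (S n) (prodA x) = (qv x + (S n).card) / 2 ^ apxB (S n) := by
  have h : ∑ p ∈ S n, apxU (S n) p (prodA x % p) = qv x := by
    rw [qv, wsum_quotWt (S_prime n) (S_le n)]
    exact Finset.sum_congr rfl fun p hp => by rw [prodSel_mod x hp]
  rw [crtK_eq_approx (S n) (S_prime n) (four_mul_prodA_lt x), h]

/-! ### Layer 3: the summands `crtT p (Π mod p)` and `2^T − κ M` -/

/-- The working width `T = |S| + |S| L`: `|S| · M < 2^T`. [folklore] -/
def T (n : ℕ) : ℕ := (S n).card + (S n).card * L n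

/-- `M ≤ 2^{|S| L}`. [folklore] -/
theorem crtM_le_two_pow (n : ℕ) : crtM (S n) ≤ 2 ^ ((S n).card * L n) := by
  unfold crtM
  calc ∏ p ∈ S n, p ≤ ∏ _p ∈ S n, 2 ^ L n :=
        Finset.prod_le_prod (fun p _ => Nat.zero_le p)
          fun p hp => (S_le n p hp).trans Nat.lt_two_pow_self.le
    _ = 2 ^ ((S n).card * L n) := by rw [Finset.prod_const, ← pow_mul, mul_comm]

/-- `|S| · M < 2^T`. [folklore] -/
theorem card_mul_crtM_lt (n : ℕ) : (S n).card * crtM (S n) < 2 ^ T n := by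
  have h1 : (S n).card < 2 ^ (S n).card := Nat.lt_two_pow_self
  calc (S n).card * crtM (S n) < 2 ^ (S n).card * crtM (S n) :=
        Nat.mul_lt_mul_of_pos_right h1 (crtM_pos (S_prime n))
    _ ≤ 2 ^ (S n).card * 2 ^ ((S n).card * L n) := Nat.mul_le_mul_left _ (crtM_le_two_pow n)
    _ = 2 ^ ((S n).card + (S n).card * L n) := by rw [← pow_add]
    _ = 2 ^ T n := rfl

/-- `n² < T`. [folklore] -/
theorem sq_lt_T (n : ℕ) : n * n < T n := by
  have h2 : n * n ≤ L n := by
    unfold L primeBound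
    calc n * n ≤ 2 * (n * n) := Nat.le_mul_of_pos_left _ two_pos
      _ ≤ 2 * (n * n) + 2 ^ 24 + 8 := le_add_right (Nat.le_add_right _ _)
  have h3 : L n ≤ (S n).card * L n := Nat.le_mul_of_pos_left _ (card_S_pos n)
  have h4 := card_S_pos n
  unfold T
  omega

/-- The hard-wired summands masked by the wires: `crtT p ρ` on the residue wire `(p, ρ)`, and
`2^T − κ(v) M` on the quotient wire `v`, `κ(v) = (v + |S|) / 2^b`. [cite: Vollmer1999, §1.4.2, proof of Thm. 1.40, eq. (1.7) (`a = a' − q·p`)] -/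
def num (n : ℕ) : Wire n → ℕ
  | Sum.inl v => 2 ^ T n - ((v : ℕ) + (S n).card) / 2 ^ apxB (S n) * crtM (S n)
  | Sum.inr q => crtT (S n) q.1 q.2

/-- `num` on a quotient wire. [folklore] -/
theorem num_inl (v : Fin (quotRange (S n).card)) :
    num n (Sum.inl v) = 2 ^ T n - ((v : ℕ) + (S n).card) / 2 ^ apxB (S n) * crtM (S n) := rfl

/-- `num` on a residue wire. [folklore] -/
theorem num_inr (q : ↥(S n) × Fin (L n + 1)) : num n (Sum.inr q) = crtT (S n) q.1 q.2 := rfl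

/-- The input width of the adders. [folklore] -/
def WU (n : ℕ) : ℕ := T n + 1

/-- Every summand fits in `WU` bits. [folklore] -/
theorem num_lt (w : Wire n) : num n w < 2 ^ WU n := by
  have hT : 2 ^ T n < 2 ^ WU n := Nat.pow_lt_pow_right one_lt_two (Nat.lt_succ_self _)
  cases w with
  | inl v => exact (Nat.sub_le _ _).trans_lt hT
  | inr q =>
    have h1 := crtT_lt (S n) (S_prime n) q.1 q.2
    have h2 : crtM (S n) ≤ (S n).card * crtM (S n) := Nat.le_mul_of_pos_left _ (card_S_pos n)
    exact ((h1.trans_le h2).trans (card_mul_crtM_lt n)).trans hT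

/-- **The sum of the masked summands is `2^T + Π`** (`∑_p crtT p (Π mod p) = κ M + Π`). [cite: Vollmer1999, §1.4.2, proof of Thm. 1.40, eq. (1.7)] -/
theorem wsum_num_wires (x : Inp n → Bool) : wsum (num n) (wires n x) = 2 ^ T n + prodA x := by
  have hS := S_prime n
  -- the quotient part
  have hq : (∑ v : Fin (quotRange (S n).card), num n (Sum.inl v) * (wires n x (Sum.inl v)).toNat) =
      2 ^ T n - crtK (S n) (prodA x) * crtM (S n) := by
    have hv := qv_lt x
    rw [Finset.sum_eq_single (⟨qv x, hv⟩ : Fin (quotRange (S n).card))]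
    · have hw : wires n x (Sum.inl ⟨qv x, hv⟩) = true := by
        rw [wires_inl, Fin.val_mk]
        exact decide_eq_true (qv_def x).symm
      rw [hw, Bool.toNat_true, mul_one, num_inl, Fin.val_mk, crtK_eq x]
    · intro v _ hne
      have hne' : (v : ℕ) ≠ qv x := fun h' => hne (Fin.ext (h'.trans (Fin.val_mk hv).symm))
      have hw : wires n x (Sum.inl v) = false := by
        rw [wires_inl]
        exact decide_eq_false fun h => hne' (h.symm.trans (qv_def x).symm)
      rw [hw, Bool.toNat_false, mul_zero]
    · intro h; exact absurd (Finset.mem_univ _) h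
  -- the residue part
  have hr : (∑ q : ↥(S n) × Fin (L n + 1), num n (Sum.inr q) * (wires n x (Sum.inr q)).toNat) =
      crtK (S n) (prodA x) * crtM (S n) + prodA x := by
    have h0 : (∑ q : ↥(S n) × Fin (L n + 1), num n (Sum.inr q) * (wires n x (Sum.inr q)).toNat) =
        wsum (fun q : ↥(S n) × Fin (L n + 1) => crtT (S n) q.1 q.2)
          (oneHotWires (resSel 1 (ftab n) (S n) (L n)) (oneHotWires (bsel n) x)) := by
      unfold wsum
      exact Finset.sum_congr rfl fun q _ => by rw [num_inr, wires_inr]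
    rw [h0, wsum_oneHotWires, ← crtSum_eq (S n) hS (prodA_lt_crtM x)]
    unfold crtSum
    rw [← Finset.sum_coe_sort (S n)]
    refine Finset.sum_congr rfl fun p _ => ?_
    show crtT (S n) p (resSel 1 (ftab n) (S n) (L n) (oneHotWires (bsel n) x) p : ℕ) =
      crtT (S n) p (prodA x % p)
    rw [resSel_prodA x p]
  have hκ : crtK (S n) (prodA x) * crtM (S n) ≤ 2 ^ T n := by
    have hk := crtK_lt (S n) hS (prodA x)
    calc crtK (S n) (prodA x) * crtM (S n) ≤ (S n).card * crtM (S n) :=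
          Nat.mul_le_mul_right _ (Nat.lt_succ_iff.1 hk)
      _ ≤ 2 ^ T n := (card_mul_crtM_lt n).le
  unfold wsum
  rw [Fintype.sum_sum_type, hq, hr]
  omega

/-- The number of summands (the wires and the unused offset slot). [folklore] -/
def Nn (n : ℕ) : ℕ := Fintype.card (Option (Wire n))

/-- The enumeration of the summands. [folklore] -/
def eW (n : ℕ) : Fin (Nn n) ≃ Option (Wire n) := (Fintype.equivFin (Option (Wire n))).symm

/-- The sum computed by the adders is `2^T + Π`. [folklore] -/
theorem total_wires (x : Inp n → Bool) :
    total (XbitsG (WU := WU n) (eW n) 0 (num n) (wires n x)) = 2 ^ T n + prodA x := by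
  rw [total_XbitsG_eq (eW n) (Nat.two_pow_pos _) (num_lt (n := n)) (wires n x), zero_add,
    wsum_num_wires]

/-- Size of layers 1–3. [folklore] -/
def bitsSize (n : ℕ) : ℕ := candSizeG (Nn n) (WU n) (n * n + 1) + wiresSize n

/-- **Layers 1–3**: the bits `t ≤ n²` of `2^T + Π` (i.e. of `Π`), depth `23`. [cite: Vollmer1999, Thm. 1.40 (§1.4.2) with Thm. 1.37 (§1.4.1)] -/
theorem acVecOver_bits :
    ACVecOver tcBasis (fun (x : Inp n → Bool) (t : Fin (n * n + 1)) => (2 ^ T n + prodA x).testBit t)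
      23 (bitsSize n) := by
  have h := (acVecOver_candBitsG (WU := WU n) (eW n) 0 (num n) (n * n + 1)).comp
    (acVecOver_wires (n := n))
  refine (h.congr fun x t => ?_).mono le_rfl le_rfl
  rw [total_wires]

/-! ### Layer 4: the count of the index part and the output -/

/-- Size of the count layer. [folklore] -/
def cntSize (n : ℕ) : ℕ := (n * n + 1) * (4 * (n * n + n * n) + 11)

/-- One count test `[cnt = i]`, depth `3`. [cite: Vollmer1999, §1.4.1, proof of Thm. 1.37 (`[x = r] = T_r ∧ ¬T_{r+1}`)] -/
theorem acRealOver_cntBit (i : Fin (n * n + 1)) :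
    ACRealOver tcBasis (fun x : Inp n → Bool => decide (cnt x = (i : ℕ))) 3
      (4 * (n * n + n * n) + 11) := by
  have h := (acRealOver_wsum_eq (α := Fin (n * n)) (fun _ => 1) (i : ℕ)).rewire
    (fun t : Fin (n * n) => (Sum.inr t : Inp n))
  refine (h.congr fun x => rfl).mono le_rfl ?_
  have hi := i.2
  simp only [Finset.sum_const, Finset.card_univ, Fintype.card_fin, smul_eq_mul, mul_one]
  omega

/-- The count layer `([cnt = i])_{i ≤ n²}`, depth `3`. [cite: Vollmer1999, §1.4.1, proof of Thm. 1.37] -/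
theorem acVecOver_cnt :
    ACVecOver tcBasis (fun (x : Inp n → Bool) (i : Fin (n * n + 1)) => decide (cnt x = (i : ℕ))) 3
      (cntSize n) :=
  acVecOver_ofBlocks_const (f := fun (i : Fin (n * n + 1)) (x : Inp n → Bool) =>
    decide (cnt x = (i : ℕ))) fun i => acRealOver_cntBit i

/-- The wires read by the output formula, generically: count tests `[c = i]` (`inl i`) and the
bits of `V` (`inr i`).  (Generic in `c`, `V` so that no closed term is ever evaluated.) [folklore] -/
def Zg (N c V : ℕ) : Fin N ⊕ Fin N → Bool :=
  Sum.elim (fun i => decide (c = (i : ℕ))) (fun i => V.testBit i)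

/-- The output formula, generically: `⋁_i [c = i] ∧ [bit i of V]`. [cite: HesseAllenderBarrington2002, §2 (p. 4): `Imult(A₁,…,A_n,i)` = bit `i` of the product] -/
def outg (N c V : ℕ) : Bool :=
  decide (∃ i : Fin N, Zg N c V (Sum.inl i) = true ∧ Zg N c V (Sum.inr i) = true)

/-- **Semantics of the output formula**: for `c < N ≤ T`, the output on `V = 2^T + P` is bit `c`
of `P`. [folklore] -/
theorem outg_eq {N c Tv P : ℕ} (hcN : c < N) (hNT : N ≤ Tv) :
    outg N c (2 ^ Tv + P) = P.testBit c := by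
  unfold outg Zg
  simp only [Sum.elim_inl, Sum.elim_inr, decide_eq_true_eq]
  rw [Bool.eq_iff_iff, decide_eq_true_eq]
  constructor
  · rintro ⟨i, hi, hb⟩
    rw [Nat.testBit_two_pow_add_gt (i.2.trans_le hNT)] at hb
    rw [hi]; exact hb
  · intro hb
    refine ⟨⟨c, hcN⟩, rfl, ?_⟩
    show (2 ^ Tv + P).testBit c = true
    rw [Nat.testBit_two_pow_add_gt (hcN.trans_le hNT)]
    exact hb

/-- The wires read by the output formula: count tests and the bits of `2^T + Π`. [folklore] -/
def Z (x : Inp n → Bool) : Fin (n * n + 1) ⊕ Fin (n * n + 1) → Bool :=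
  Zg (n * n + 1) (cnt x) (2 ^ T n + prodA x)

/-- The `Z` layer, depth `23`. [folklore] -/
theorem acVecOver_Z : ACVecOver tcBasis (Z (n := n)) 23 (cntSize n + bitsSize n) :=
  ((acVecOver_cnt (n := n)).prod (acVecOver_bits (n := n))).mono (by norm_num) le_rfl

/-- **The output**: `⋁_i [cnt = i] ∧ [bit i of 2^T + Π]`. [cite: HesseAllenderBarrington2002, §2 (p. 4): `Imult(A₁,…,A_n,i)` = bit `i` of the product] -/
def outF (x : Inp n → Bool) : Bool := outg (n * n + 1) (cnt x) (2 ^ T n + prodA x)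

/-- Size of the whole structured circuit. [folklore] -/
def outSize (n : ℕ) : ℕ := (n * n + 1) * 1 + 1 + (cntSize n + bitsSize n)

/-- **The structured circuit**: depth `25`, `outSize n` gates. [cite: Vollmer1999, Thm. 1.40] -/
theorem acRealOver_outF : ACRealOver tcBasis (outF (n := n)) 25 (outSize n) := by
  have h := (acRealOver_exists_and₂ acBasis_subset_tcBasis
    (Sum.inl : Fin (n * n + 1) → Fin (n * n + 1) ⊕ Fin (n * n + 1)) Sum.inr).compVec
    (acVecOver_Z (n := n))
  refine (h.congr fun x => decide_eq_decide.2 Iff.rfl).mono le_rfl ?_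
  rw [Fintype.card_fin]
  exact le_rfl

/-- **Correctness of the structured circuit**: the output is bit `cnt` of `Π`. [cite: HesseAllenderBarrington2002, §2 (p. 4)] -/
theorem outF_eq (x : Inp n → Bool) : outF x = (prodA x).testBit (cnt x) :=
  outg_eq (Nat.lt_succ_of_le (cnt_le x)) (Nat.succ_le_of_lt (sq_lt_T n))

/-! ### Transport to the input words `Fin (n² + n²) → Bool` and the language `IMULT` -/

/-- The embedding of the structured input variables into the positions of a word of length
`2n²`: block `j`, bit `k` at `jn + k`; index bit `t` at `n² + t`. [cite: HesseAllenderBarrington2002, §2 (p. 4)] -/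
def emb (n : ℕ) : Inp n → Fin (n * n + n * n)
  | Sum.inl q => Fin.castAdd (n * n) ⟨(q.1 : ℕ) * n + q.2, by
      have h1 := q.1.2
      have h2 := q.2.2
      calc (q.1 : ℕ) * n + q.2 < q.1 * n + n := by omega
        _ = (q.1 + 1) * n := by ring
        _ ≤ n * n := Nat.mul_le_mul_right _ h1⟩
  | Sum.inr t => Fin.natAdd (n * n) t

/-- The structured circuit read through the embedding: depth `25`, `outSize n` gates. [cite: Vollmer1999, Thm. 1.40] -/
theorem acRealOver_imult (n : ℕ) :
    ACRealOver tcBasis (fun y : Fin (n * n + n * n) → Bool => outF (fun i => y (emb n i))) 25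
      (outSize n) :=
  acRealOver_outF.rewire (emb n)

/-- Block values agree with `blockVal`. [folklore] -/
theorem aval_emb (y : Fin (n * n + n * n) → Bool) (j : Fin n) :
    aval (fun i => y (emb n i)) j = blockVal (List.ofFn y) ((j : ℕ) * n) n := by
  simp only [aval, wsum, blockVal]
  rw [← Fin.sum_univ_eq_sum_range
    (fun k => if (List.ofFn y).getD ((j : ℕ) * n + k) false then 2 ^ k else 0) n]
  refine Finset.sum_congr rfl fun k _ => ?_
  have hlt : (j : ℕ) * n + k < (List.ofFn y).length := by
    rw [List.length_ofFn]
    exact (emb n (Sum.inl (j, k))).2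
  have hget : (List.ofFn y).getD ((j : ℕ) * n + k) false = y (emb n (Sum.inl (j, k))) := by
    rw [List.getD_eq_getElem _ _ hlt, List.getElem_ofFn]
    rfl
  rw [hget]
  rcases Bool.eq_false_or_eq_true (y (emb n (Sum.inl (j, k)))) with h | h <;> simp [h]

/-- The product agrees with `imultProd`. [folklore] -/
theorem prodA_emb (y : Fin (n * n + n * n) → Bool) :
    prodA (fun i => y (emb n i)) = imultProd (List.ofFn y) n := by
  unfold prodA imultProd
  rw [← Fin.prod_univ_eq_prod_range (fun j => blockVal (List.ofFn y) (j * n) n) n]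
  exact Fintype.prod_congr _ _ fun j => aval_emb y j

/-- Counting the `true` entries of a tuple (private copy of a folklore lemma of the tree). [folklore] -/
private theorem count_true_ofFn {m : ℕ} (b : Fin m → Bool) :
    (List.ofFn b).count true = (Finset.univ.filter fun j => b j = true).card := by
  induction m with
  | zero => simp
  | succ m ih =>
    rw [List.ofFn_succ, List.count_cons, ih (fun j => b j.succ), Finset.card_filter,
      Finset.card_filter, Fin.sum_univ_succ, add_comm]
    congr 1
    simp

/-- The count agrees with the number of ones of the index part of the word. [folklore] -/
theorem cnt_emb (y : Fin (n * n + n * n) → Bool) :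
    cnt (fun i => y (emb n i)) = ((List.ofFn y).drop (n * n)).count true := by
  have hdrop : (List.ofFn y).drop (n * n) =
      List.ofFn (fun t : Fin (n * n) => y (emb n (Sum.inr t))) := by
    apply List.ext_getElem
    · simp
    · intro i h₁ h₂
      simp only [List.getElem_drop, List.getElem_ofFn]
      rfl
  rw [hdrop, count_true_ofFn, cnt, wsum_one]

/-- Membership of a word of length `2n²` in `IMULT`. [cite: HesseAllenderBarrington2002, §2 (p. 4)] -/
theorem ofFn_mem_IMULT_iff (y : Fin (n * n + n * n) → Bool) :
    List.ofFn y ∈ (IMULT : Set (List Bool)) ↔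
      (imultProd (List.ofFn y) n).testBit (((List.ofFn y).drop (n * n)).count true) = true := by
  constructor
  · rintro ⟨n', hlen, h⟩
    rw [List.length_ofFn] at hlen
    have hn : n' = n := by
      have : n' * n' = n * n := by linarith
      exact Nat.mul_self_inj.1 this
    subst hn
    exact h
  · intro h
    exact ⟨n, by rw [List.length_ofFn]; ring, h⟩

/-- **Correctness**: the circuit decides the slice of `IMULT`. [cite: HesseAllenderBarrington2002, §2 (p. 4) and Cor. 6.3 (p. 16)] -/
theorem outF_emb (y : Fin (n * n + n * n) → Bool) :
    outF (fun i => y (emb n i)) = IMULT.boolIndicator (List.ofFn y) := by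
  rw [outF_eq, prodA_emb, cnt_emb]
  by_cases h : List.ofFn y ∈ (IMULT : Set (List Bool))
  · rw [(Set.mem_iff_boolIndicator (IMULT : Set (List Bool)) _).1 h]
    exact (ofFn_mem_IMULT_iff y).1 h
  · rw [(Set.notMem_iff_boolIndicator (IMULT : Set (List Bool)) _).1 h]
    exact Bool.eq_false_iff.2 fun hb => h ((ofFn_mem_IMULT_iff y).2 hb)

/-! ### The size bound as a semiring expression -/

section Semiring

variable {R : Type*} [CommSemiring R]

/-- `L` as a semiring expression. [folklore] -/
def LR (x : R) : R := 2 * (x * x) + 2 ^ 24 + 8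

/-- Bound for `|S|`. [folklore] -/
def kR (x : R) : R := LR x + 1

/-- `blk₁` as a semiring expression. [folklore] -/
def blk1R (x : R) : R := (x * LR x + 1) * (4 * (x * LR x + (x * LR x + 1)) + 11) + 1

/-- Bound for `cF`. [folklore] -/
def cFR (x : R) : R := kR x * x * (LR x + 1)

/-- Bound for `wiresSize`. [folklore] -/
def wiresR (x : R) : R := crtLayerSizeR (cFR x) (kR x) (LR x) + cFR x * blk1R x

/-- Bound for `Nn`. [folklore] -/
def NsR (x : R) : R := quotRangeR (kR x) + kR x * (LR x + 1) + 1

/-- Bound for `WU`. [folklore] -/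
def WsR (x : R) : R := kR x + kR x * LR x + 1

/-- Bound for `bitsSize`. [folklore] -/
def bitsR (x : R) : R := itAddBoundR (NsR x) (x * x + 1) + NsR x * WsR x * 1 + wiresR x

/-- `cntSize` as a semiring expression. [folklore] -/
def cntR (x : R) : R := (x * x + 1) * (4 * (x * x + x * x) + 11)

/-- **The size polynomial** (bound for `outSize`). [folklore] -/
def outR (x : R) : R := (x * x + 1) * 1 + 1 + (cntR x + bitsR x)

variable {R' : Type*} [CommSemiring R'] (f : R →+* R')

/-- Ring homomorphisms commute with `LR`. [folklore] -/
theorem map_LR (x : R) : f (LR x) = LR (f x) := by simp [LR, map_ofNat]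

/-- … with `kR`. [folklore] -/
theorem map_kR (x : R) : f (kR x) = kR (f x) := by simp [kR, map_LR]

/-- … with `blk1R`. [folklore] -/
theorem map_blk1R (x : R) : f (blk1R x) = blk1R (f x) := by simp [blk1R, map_LR, map_ofNat]

/-- … with `cFR`. [folklore] -/
theorem map_cFR (x : R) : f (cFR x) = cFR (f x) := by simp [cFR, map_kR, map_LR]

/-- … with `wiresR`. [folklore] -/
theorem map_wiresR (x : R) : f (wiresR x) = wiresR (f x) := by
  simp [wiresR, map_crtLayerSizeR, map_cFR, map_kR, map_LR, map_blk1R]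

/-- … with `NsR`. [folklore] -/
theorem map_NsR (x : R) : f (NsR x) = NsR (f x) := by
  simp [NsR, map_quotRangeR, map_kR, map_LR]

/-- … with `WsR`. [folklore] -/
theorem map_WsR (x : R) : f (WsR x) = WsR (f x) := by simp [WsR, map_kR, map_LR]

/-- … with `bitsR`. [folklore] -/
theorem map_bitsR (x : R) : f (bitsR x) = bitsR (f x) := by
  simp [bitsR, map_itAddBoundR, map_NsR, map_WsR, map_wiresR]

/-- … with `cntR`. [folklore] -/
theorem map_cntR (x : R) : f (cntR x) = cntR (f x) := by simp [cntR, map_ofNat]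

/-- … with `outR`. [folklore] -/
theorem map_outR (x : R) : f (outR x) = outR (f x) := by simp [outR, map_cntR, map_bitsR]

end Semiring

/-- `outR X` evaluates to `outR m`. [folklore] -/
theorem eval_outR (m : ℕ) : (outR (X : ℕ[X])).eval m = outR m := by
  have h := map_outR (Polynomial.evalRingHom m) (X : ℕ[X])
  rwa [Polynomial.coe_evalRingHom, Polynomial.eval_X] at h

/-- Evaluation of a polynomial with natural coefficients is monotone. [folklore] -/
theorem eval_mono_nat (P : ℕ[X]) {a b : ℕ} (h : a ≤ b) : P.eval a ≤ P.eval b := by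
  rw [Polynomial.eval_eq_sum_range, Polynomial.eval_eq_sum_range]
  exact Finset.sum_le_sum fun i _ => Nat.mul_le_mul_left _ (Nat.pow_le_pow_left h i)

/-! ### Comparing the size with the bound -/

/-- `L = LR` on `ℕ`. [folklore] -/
theorem L_eq (n : ℕ) : L n = LR n := rfl

/-- `|S| ≤ kR n`. [folklore] -/
theorem card_S_le (n : ℕ) : (S n).card ≤ kR n :=
  (Finset.card_filter_le _ _).trans (by rw [Finset.card_range]; exact le_rfl)

/-- `cF = |S| · n · (L + 1)`. [folklore] -/
theorem cF_eq (n : ℕ) : cF n = (S n).card * n * (L n + 1) := by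
  unfold cF
  rw [Fintype.card_prod, Fintype.card_prod, Fintype.card_coe, Fintype.card_fin, Fintype.card_fin]

/-- `cF ≤ cFR`. [folklore] -/
theorem cF_le (n : ℕ) : cF n ≤ cFR n := by
  rw [cF_eq]
  unfold cFR
  rw [← L_eq]
  have h := card_S_le n
  gcongr

/-- `Nn ≤ NsR`. [folklore] -/
theorem Nn_le (n : ℕ) : Nn n ≤ NsR n := by
  unfold Nn NsR
  rw [Fintype.card_option, Fintype.card_sum, Fintype.card_fin, Fintype.card_prod, Fintype.card_coe,
    Fintype.card_fin, ← quotRange_eq, ← L_eq]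
  have h := card_S_le n
  exact Nat.succ_le_succ (Nat.add_le_add (quotRange_mono h) (Nat.mul_le_mul_right _ h))

/-- `WU ≤ WsR`. [folklore] -/
theorem WU_le (n : ℕ) : WU n ≤ WsR n := by
  unfold WU T WsR
  rw [← L_eq]
  have h := card_S_le n
  exact Nat.succ_le_succ (Nat.add_le_add h (Nat.mul_le_mul_right _ h))

/-- `bitsSize ≤ bitsR`. [folklore] -/
theorem bitsSize_le (n : ℕ) : bitsSize n ≤ bitsR n := by
  have hN := Nn_le n
  have hW := WU_le n
  have hF := cF_le n
  have hk := card_S_le n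
  have hA : itAddSize (Nn n) (n * n + 1) ≤ itAddBoundR (NsR n) (n * n + 1) :=
    (itAddSize_le _ _).trans (itAddBoundR_mono hN le_rfl)
  have hC : crtLayerSize (cF n) (S n).card (L n) ≤ crtLayerSize (cFR n) (kR n) (LR n) :=
    crtLayerSize_mono hF hk (le_of_eq (L_eq n))
  have hB : layer1Size n ≤ cFR n * blk1R n := by
    unfold layer1Size
    exact Nat.mul_le_mul_right _ hF
  have hD : Fintype.card (Fin (Nn n) × Fin (WU n)) * 1 ≤ NsR n * WsR n * 1 := by
    rw [Fintype.card_prod, Fintype.card_fin, Fintype.card_fin]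
    exact Nat.mul_le_mul_right _ (Nat.mul_le_mul hN hW)
  unfold bitsSize candSizeG bitsR wiresSize wiresR
  rw [← crtLayerSize_eq]
  omega

/-- **The size of the circuit is at most the bound.** [folklore] -/
theorem outSize_le (n : ℕ) : outSize n ≤ outR n := by
  have hb := bitsSize_le n
  have hc : cntSize n = cntR n := rfl
  unfold outSize outR
  rw [hc]
  omega

/-! ### The circuit family -/

/-- **The slices of `IMULT` in depth `25` and polynomial size**: for every input length `m`,
`y ↦ [List.ofFn y ∈ IMULT]` is realized over `tcBasis` at depth `25` with at most `outR m` gates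
(the structured circuit for `m = 2n²`, a constant otherwise). [cite: HesseAllenderBarrington2002, Cor. 6.3 (p. 16); Vollmer1999, Thm. 1.40] -/
theorem acRealOver_slice (m : ℕ) :
    ACRealOver tcBasis (fun y : Fin m → Bool => IMULT.boolIndicator (List.ofFn y)) 25
      ((outR (X : ℕ[X])).eval m) := by
  by_cases h : ∃ n, m = n * n + n * n
  · obtain ⟨n, rfl⟩ := h
    refine ((acRealOver_imult n).congr fun y => outF_emb y).mono le_rfl ?_
    calc outSize n ≤ outR n := outSize_le n
      _ = (outR (X : ℕ[X])).eval n := (eval_outR n).symm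
      _ ≤ (outR (X : ℕ[X])).eval (n * n + n * n) :=
          eval_mono_nat _ ((Nat.le_mul_self n).trans (Nat.le_add_right _ _))
  · refine ((acRealOver_const acBasis_subset_tcBasis false).congr fun y => ?_).mono (by norm_num) ?_
    · have hy : List.ofFn y ∉ (IMULT : Set (List Bool)) := by
        rintro ⟨n', hlen, -⟩
        rw [List.length_ofFn] at hlen
        exact h ⟨n', by omega⟩
      exact ((Set.notMem_iff_boolIndicator (IMULT : Set (List Bool)) _).1 hy).symm
    · rw [eval_outR]
      unfold outR
      omega

end IMult

/-- **Hesse–Allender–Barrington 2002, Corollary 6.3 (non-uniform part), proved**: `IMULT ∈ TC0`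
— iterated multiplication of `n` numbers of `n` bits (as the bit-predicate language `IMULT`) is
decided by constant-depth (`25`), polynomial-size (`IMult.outR`) threshold circuit families, by the
Chinese-remainder algorithm of Beame–Cook–Hoover (residues modulo small primes by discrete
logarithms, CRT reconstruction by iterated addition; Vollmer 1999, Thm. 1.40). [cite: HesseAllenderBarrington2002, Corollary 6.3 (p. 16) with §2.3 (p. 6) and §3 (p. 7); Vollmer1999, §1.4.2, Thm. 1.40] -/
theorem hesseAllenderBarrington2002_imult_mem_TC0_holds :
    hesseAllenderBarrington2002_imult_mem_TC0 := by
  choose C hB hd hs hC using fun m => (IMult.acRealOver_slice m).toCircuit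
  refine ⟨25, IMult.outR (X : ℕ[X]), C, fun m => ⟨hB m, hd m, hs m⟩, fun x => ?_⟩
  rw [hC x.length x.get]
  beta_reduce
  rw [List.ofFn_get]

end Literature.Computability.Complexity

end
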